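import Summits.Ventures.YMGap.RobustBall.DirectionalSusceptibilityS
import HarnessLib

/-!
# Venture YMGap, track ROBUST-BALL (Y2) — TIER 2: SUMMING THE SIXTEEN-TREE MAJORANT WITH PER-LINK LOADS

HONEST FRAMING. WHAT THIS IS: a venture file (cell `pub-ymgap`, track Y2 ROBUST-BALL, seat rb-p1, theorems only): pure bookkeeping on `ℤ^d` links, no
measure.  For a nonempty finite link set `Λ_F`, nonnegative per-set weights `L_X` (`L_∅ = 0`) with per-link loads `Σ'_{X∋e} L_X ≤ L`, `Σ'_{X∋e} #X·L_X ≤ L₂`,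
`Σ'_{X∋e} #X²·L_X ≤ L₃`, the profile `g_Δ(e) = e^{−s·dist(Δ,e)}` (`s > 0`, link-sum constant `C_s = d((1+e^{−s/d})/(1−e^{−s/d}))^d` of
`DirectionalSusceptibilityS`) and `G_P(C) = Σ_{e∈C} g_P(e)`:
* `sum3_le_of_peel_S` — peeling a rooted tree of depth ≤ 3 from its leaves (generic three-level summation lemma);
* ★ `sum_tree16_le_S` — for all finite families `T, T', T''`:
  `Σ_{X∈T} Σ_{Y∈T'} Σ_{Z∈T''} L_X L_Y L_Z Σ_{16 trees} Π_{(P→C)} G_P(C) ≤ C_s³ #Λ_F L (#Λ_F² L² + 3 L L₃ + 6 L₂² + 6 #Λ_F L L₂)`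
  (one star at the root, three stars at a piece, six paths from the root, six paths through the root) — the uniform bound on the partial sums of the
  third-order susceptibility majorant of `FourPointMajorantS`.
WHAT THIS IS NOT: anything about measures; the constants are not optimised.
-/

noncomputable section

open Finset Real
open Literature.MathematicalPhysics.QuantumLattice
open Literature.MathematicalPhysics.QuantumFieldTheory hiding ZdEdge

namespace Summit.Ventures.YMGap.RobustBall

variable {d : ℕ}

/-- **Peeling lemma.**  A three-level sum `Σ_A Σ_B Σ_C u(A) v(A,B) w(A,B,C)` of nonnegative terms, where `u` vanishes off the `good` sets and `v(A,·)` vanishes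
off the good sets, is bounded by peeling: `Σ_C w ≤ W(A,B)` for good `A, B`, `Σ_B v·W ≤ V(A)` for good `A`, `Σ_A u·V ≤ U`. -/
theorem sum3_le_of_peel_S {α : Type*} {S₁ S₂ S₃ : Finset α} {good : α → Prop} {u : α → ℝ} {v : α → α → ℝ} {w : α → α → α → ℝ}
    {Wb : α → α → ℝ} {Vb : α → ℝ} {U : ℝ} (hu0 : ∀ A, 0 ≤ u A) (hv0 : ∀ A B, 0 ≤ v A B) (hw0 : ∀ A B C, 0 ≤ w A B C)
    (hue : ∀ A, ¬good A → u A = 0) (hve : ∀ A B, ¬good B → v A B = 0)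
    (hW : ∀ A B, good A → good B → ∑ C ∈ S₃, w A B C ≤ Wb A B) (hV : ∀ A, good A → ∑ B ∈ S₂, v A B * Wb A B ≤ Vb A)
    (hU : ∑ A ∈ S₁, u A * Vb A ≤ U) :
    ∑ A ∈ S₁, ∑ B ∈ S₂, ∑ C ∈ S₃, u A * v A B * w A B C ≤ U := by
  classical
  refine le_trans (sum_le_sum fun A _ => ?_) hU
  by_cases hA : good A
  · have h1 : ∑ B ∈ S₂, ∑ C ∈ S₃, u A * v A B * w A B C = u A * ∑ B ∈ S₂, v A B * ∑ C ∈ S₃, w A B C := by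
      rw [mul_sum]; refine sum_congr rfl fun B _ => ?_
      rw [mul_sum, mul_sum]; exact sum_congr rfl fun C _ => by ring
    rw [h1]
    refine mul_le_mul_of_nonneg_left ((sum_le_sum fun B _ => ?_).trans (hV A hA)) (hu0 A)
    by_cases hB : good B
    · exact mul_le_mul_of_nonneg_left (hW A B hA hB) (hv0 A B)
    · rw [hve A B hB, zero_mul, zero_mul]
  · have _h := hw0
    rw [hue A hA]; simp

/-- ★ **Summing the sixteen-tree majorant with per-link loads.**  `Λ_F` nonempty, weights `L_X ≥ 0` with `L_∅ = 0` and loads `L, L₂, L₃` (plain, size-weighted,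
size²-weighted) through every link, profile `g_Δ(e) = e^{−s·dist(Δ,e)}`, `C_s` the link-sum constant; then for all finite families `T, T', T''`:
`Σ_X Σ_Y Σ_Z L_X L_Y L_Z · (16-tree sum) ≤ C_s³ #Λ_F L (#Λ_F² L² + 3 L L₃ + 6 L₂² + 6 #Λ_F L L₂)`. -/
theorem sum_tree16_le_S (hd : 1 ≤ d) {s : ℝ} (hs : 0 < s) {ΛF : Finset (ZdEdge d)} (hF : ΛF.Nonempty)
    {LX : Finset (ZdEdge d) → ℝ} (hLX0 : ∀ X, 0 ≤ LX X) (hLXe : LX ∅ = 0) {L L₂ L₃ : ℝ}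
    (hLs : ∀ e, Summable fun X : Finset (ZdEdge d) => (if e ∈ X then LX X else 0))
    (hL : ∀ e, ∑' X : Finset (ZdEdge d), (if e ∈ X then LX X else 0) ≤ L)
    (hL2s : ∀ e, Summable fun X : Finset (ZdEdge d) => (if e ∈ X then (X.card : ℝ) * LX X else 0))
    (hL2 : ∀ e, ∑' X : Finset (ZdEdge d), (if e ∈ X then (X.card : ℝ) * LX X else 0) ≤ L₂)
    (hL3s : ∀ e, Summable fun X : Finset (ZdEdge d) => (if e ∈ X then (X.card : ℝ) ^ 2 * LX X else 0))
    (hL3 : ∀ e, ∑' X : Finset (ZdEdge d), (if e ∈ X then (X.card : ℝ) ^ 2 * LX X else 0) ≤ L₃)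
    {gD : Finset (ZdEdge d) → ZdEdge d → ℝ} (hgD : gD = fun Δ e => exp (-s * linkSetDist Δ e))
    {Cs : ℝ} (hCs : Cs = (d : ℝ) * ((1 + exp (-(s / d))) / (1 - exp (-(s / d)))) ^ d) (T T' T'' : Finset (Finset (ZdEdge d))) :
    ∑ X ∈ T, ∑ Y ∈ T', ∑ Z ∈ T'', LX X * LX Y * LX Z *
        ((∑ e ∈ X, gD ΛF e) * (∑ e ∈ Y, gD ΛF e) * (∑ e ∈ Z, gD ΛF e) +
        (∑ e ∈ X, gD ΛF e) * (∑ e ∈ Y, gD X e) * (∑ e ∈ Z, gD X e) +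
        (∑ e ∈ Y, gD ΛF e) * (∑ e ∈ X, gD Y e) * (∑ e ∈ Z, gD Y e) +
        (∑ e ∈ Z, gD ΛF e) * (∑ e ∈ X, gD Z e) * (∑ e ∈ Y, gD Z e) +
        (∑ e ∈ X, gD ΛF e) * (∑ e ∈ Y, gD X e) * (∑ e ∈ Z, gD Y e) +
        (∑ e ∈ X, gD ΛF e) * (∑ e ∈ Z, gD X e) * (∑ e ∈ Y, gD Z e) +
        (∑ e ∈ Y, gD ΛF e) * (∑ e ∈ X, gD Y e) * (∑ e ∈ Z, gD X e) +
        (∑ e ∈ Y, gD ΛF e) * (∑ e ∈ Z, gD Y e) * (∑ e ∈ X, gD Z e) +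
        (∑ e ∈ Z, gD ΛF e) * (∑ e ∈ X, gD Z e) * (∑ e ∈ Y, gD X e) +
        (∑ e ∈ Z, gD ΛF e) * (∑ e ∈ Y, gD Z e) * (∑ e ∈ X, gD Y e) +
        (∑ e ∈ X, gD ΛF e) * (∑ e ∈ Y, gD ΛF e) * (∑ e ∈ Z, gD Y e) +
        (∑ e ∈ X, gD ΛF e) * (∑ e ∈ Z, gD ΛF e) * (∑ e ∈ Y, gD Z e) +
        (∑ e ∈ Y, gD ΛF e) * (∑ e ∈ X, gD ΛF e) * (∑ e ∈ Z, gD X e) +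
        (∑ e ∈ Y, gD ΛF e) * (∑ e ∈ Z, gD ΛF e) * (∑ e ∈ X, gD Z e) +
        (∑ e ∈ Z, gD ΛF e) * (∑ e ∈ X, gD ΛF e) * (∑ e ∈ Y, gD X e) +
        (∑ e ∈ Z, gD ΛF e) * (∑ e ∈ Y, gD ΛF e) * (∑ e ∈ X, gD Y e)) ≤
      Cs ^ 3 * ΛF.card * L * ((ΛF.card : ℝ) ^ 2 * L ^ 2 + 3 * L * L₃ + 6 * L₂ ^ 2 + 6 * ΛF.card * L * L₂) := by
  classical
  have hd0 : 0 < d := hd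
  have hgD0 : ∀ Δ e, 0 ≤ gD Δ e := fun Δ e => by rw [hgD]; exact (exp_pos _).le
  have hL0 : 0 ≤ L := le_trans (tsum_nonneg fun X => by split_ifs; exacts [hLX0 X, le_rfl]) (hL (0, ⟨0, hd0⟩))
  have hL20 : 0 ≤ L₂ :=
    le_trans (tsum_nonneg fun X => by split_ifs; exacts [mul_nonneg (Nat.cast_nonneg _) (hLX0 X), le_rfl]) (hL2 (0, ⟨0, hd0⟩))
  have hr1 : exp (-(s / d)) < 1 := Real.exp_lt_one_iff.2 (neg_lt_zero.2 (by positivity))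
  have hCs0 : 0 ≤ Cs := by
    rw [hCs]; have : 0 ≤ (1 + exp (-(s / d))) / (1 - exp (-(s / d))) := div_nonneg (by positivity) (by linarith)
    positivity
  -- the profile sums: `Σ' g_Δ ≤ #Δ · Cs` for nonempty `Δ`
  have hprof : ∀ {Δ : Finset (ZdEdge d)}, Δ.Nonempty → Summable (gD Δ) ∧ ∑' e, gD Δ e ≤ Δ.card * Cs := fun hΔ => by
    have h := summable_exp_neg_linkSetDist hd hs hΔ
    rw [← hCs] at h; rw [hgD]; exact h
  -- the hanging weight `H_P(C) = L_C · G_P(C)`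
  obtain ⟨H, hH⟩ : ∃ H : Finset (ZdEdge d) → Finset (ZdEdge d) → ℝ, H = fun P C => LX C * ∑ e ∈ C, gD P e := ⟨_, rfl⟩
  have hH0 : ∀ P C, 0 ≤ H P C := fun P C => by rw [hH]; exact mul_nonneg (hLX0 C) (sum_nonneg fun e _ => hgD0 P e)
  have hHe : ∀ P C : Finset (ZdEdge d), ¬C.Nonempty → H P C = 0 := fun P C hC => by
    rw [Finset.not_nonempty_iff_eq_empty.1 hC, hH]; simp [hLXe]
  -- one-variable estimates against a nonempty parent
  have E1 : ∀ (S : Finset (Finset (ZdEdge d))) {P : Finset (ZdEdge d)}, P.Nonempty → ∑ C ∈ S, H P C ≤ L * (P.card * Cs) := by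
    intro S P hP
    have h := sum_mul_sum_le_of_load (T := S) (hgD0 P) (hprof hP).1 hLX0 hL0 hLs hL
    simp only [hH]
    exact h.trans (mul_le_mul_of_nonneg_left (hprof hP).2 hL0)
  have E2 : ∀ (S : Finset (Finset (ZdEdge d))) {P : Finset (ZdEdge d)}, P.Nonempty →
      ∑ C ∈ S, (C.card : ℝ) * H P C ≤ L₂ * (P.card * Cs) := by
    intro S P hP
    have h := sum_mul_sum_le_of_load (T := S) (hgD0 P) (hprof hP).1 (LX := fun C => (C.card : ℝ) * LX C)
      (fun C => mul_nonneg (Nat.cast_nonneg _) (hLX0 C)) hL20 hL2s hL2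
    have heq : ∑ C ∈ S, (C.card : ℝ) * H P C = ∑ C ∈ S, (C.card : ℝ) * LX C * ∑ e ∈ C, gD P e :=
      sum_congr rfl fun C _ => by simp only [hH]; ring
    rw [heq]; exact h.trans (mul_le_mul_of_nonneg_left (hprof hP).2 hL20)
  have hL30 : 0 ≤ L₃ :=
    le_trans (tsum_nonneg fun X => by split_ifs; exacts [mul_nonneg (sq_nonneg _) (hLX0 X), le_rfl]) (hL3 (0, ⟨0, hd0⟩))
  have E3 : ∀ (S : Finset (Finset (ZdEdge d))) {P : Finset (ZdEdge d)}, P.Nonempty →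
      ∑ C ∈ S, (C.card : ℝ) ^ 2 * H P C ≤ L₃ * (P.card * Cs) := by
    intro S P hP
    have h := sum_mul_sum_le_of_load (T := S) (hgD0 P) (hprof hP).1 (LX := fun C => (C.card : ℝ) ^ 2 * LX C)
      (fun C => mul_nonneg (sq_nonneg _) (hLX0 C)) hL30 hL3s hL3
    have heq : ∑ C ∈ S, (C.card : ℝ) ^ 2 * H P C = ∑ C ∈ S, (C.card : ℝ) ^ 2 * LX C * ∑ e ∈ C, gD P e :=
      sum_congr rfl fun C _ => by simp only [hH]; ring
    rw [heq]; exact h.trans (mul_le_mul_of_nonneg_left (hprof hP).2 hL30)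
  have hK0 : 0 ≤ L * (ΛF.card * Cs) := by positivity
  have hKA : ∀ A : Finset (ZdEdge d), 0 ≤ L * (A.card * Cs) := fun A => by positivity
  -- the four tree shapes (root `Λ_F`): star at the root, star at a piece, path from the root, path through the root
  have Sa : ∀ S₁ S₂ S₃ : Finset (Finset (ZdEdge d)),
      ∑ A ∈ S₁, ∑ B ∈ S₂, ∑ C ∈ S₃, H ΛF A * H ΛF B * H ΛF C ≤ (L * (ΛF.card * Cs)) * ((L * (ΛF.card * Cs)) * (L * (ΛF.card * Cs))) :=
    fun S₁ S₂ S₃ => sum3_le_of_peel_S (good := Finset.Nonempty) (u := fun A => H ΛF A) (v := fun _ B => H ΛF B)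
      (w := fun _ _ C => H ΛF C) (Wb := fun _ _ => L * (ΛF.card * Cs)) (Vb := fun _ => (L * (ΛF.card * Cs)) * (L * (ΛF.card * Cs)))
      (fun A => hH0 _ _) (fun _ B => hH0 _ _) (fun _ _ C => hH0 _ _) (fun A hA => hHe _ _ hA) (fun _ B hB => hHe _ _ hB)
      (fun _ _ _ _ => E1 S₃ hF) (fun _ _ => by rw [← sum_mul]; exact mul_le_mul_of_nonneg_right (E1 S₂ hF) hK0)
      (by rw [← sum_mul]; exact mul_le_mul_of_nonneg_right (E1 S₁ hF) (mul_nonneg hK0 hK0))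
  have Sb : ∀ S₁ S₂ S₃ : Finset (Finset (ZdEdge d)),
      ∑ A ∈ S₁, ∑ B ∈ S₂, ∑ C ∈ S₃, H ΛF A * H A B * H A C ≤ L * Cs * (L * Cs) * (L₃ * (ΛF.card * Cs)) :=
    fun S₁ S₂ S₃ => sum3_le_of_peel_S (good := Finset.Nonempty) (u := fun A => H ΛF A) (v := fun A B => H A B)
      (w := fun A _ C => H A C) (Wb := fun A _ => L * (A.card * Cs)) (Vb := fun A => (L * (A.card * Cs)) * (L * (A.card * Cs)))
      (fun A => hH0 _ _) (fun A B => hH0 _ _) (fun A _ C => hH0 _ _) (fun A hA => hHe _ _ hA) (fun A B hB => hHe _ _ hB)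
      (fun A _ hA _ => E1 S₃ hA) (fun A hA => by rw [← sum_mul]; exact mul_le_mul_of_nonneg_right (E1 S₂ hA) (hKA A))
      (by
        have heq : ∑ A ∈ S₁, H ΛF A * (L * (A.card * Cs) * (L * (A.card * Cs))) = L * Cs * (L * Cs) * ∑ A ∈ S₁, (A.card : ℝ) ^ 2 * H ΛF A := by
          rw [mul_sum]; exact sum_congr rfl fun A _ => by ring
        rw [heq]; exact mul_le_mul_of_nonneg_left (E3 S₁ hF) (by positivity))
  have Sc : ∀ S₁ S₂ S₃ : Finset (Finset (ZdEdge d)),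
      ∑ A ∈ S₁, ∑ B ∈ S₂, ∑ C ∈ S₃, H ΛF A * H A B * H B C ≤ L * Cs * (L₂ * Cs) * (L₂ * (ΛF.card * Cs)) :=
    fun S₁ S₂ S₃ => sum3_le_of_peel_S (good := Finset.Nonempty) (u := fun A => H ΛF A) (v := fun A B => H A B)
      (w := fun _ B C => H B C) (Wb := fun _ B => L * (B.card * Cs)) (Vb := fun A => L * Cs * (L₂ * (A.card * Cs)))
      (fun A => hH0 _ _) (fun A B => hH0 _ _) (fun _ B C => hH0 _ _) (fun A hA => hHe _ _ hA) (fun A B hB => hHe _ _ hB)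
      (fun _ B _ hB => E1 S₃ hB)
      (fun A hA => by
        have heq : ∑ B ∈ S₂, H A B * (L * (B.card * Cs)) = L * Cs * ∑ B ∈ S₂, (B.card : ℝ) * H A B := by
          rw [mul_sum]; exact sum_congr rfl fun B _ => by ring
        rw [heq]; exact mul_le_mul_of_nonneg_left (E2 S₂ hA) (by positivity))
      (by
        have heq : ∑ A ∈ S₁, H ΛF A * (L * Cs * (L₂ * (A.card * Cs))) = L * Cs * (L₂ * Cs) * ∑ A ∈ S₁, (A.card : ℝ) * H ΛF A := by
          rw [mul_sum]; exact sum_congr rfl fun A _ => by ring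
        rw [heq]; exact mul_le_mul_of_nonneg_left (E2 S₁ hF) (by positivity))
  have Sd : ∀ S₁ S₂ S₃ : Finset (Finset (ZdEdge d)),
      ∑ A ∈ S₁, ∑ B ∈ S₂, ∑ C ∈ S₃, H ΛF A * H ΛF B * H B C ≤ L * Cs * (L₂ * (ΛF.card * Cs)) * (L * (ΛF.card * Cs)) :=
    fun S₁ S₂ S₃ => sum3_le_of_peel_S (good := Finset.Nonempty) (u := fun A => H ΛF A) (v := fun _ B => H ΛF B)
      (w := fun _ B C => H B C) (Wb := fun _ B => L * (B.card * Cs)) (Vb := fun _ => L * Cs * (L₂ * (ΛF.card * Cs)))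
      (fun A => hH0 _ _) (fun _ B => hH0 _ _) (fun _ B C => hH0 _ _) (fun A hA => hHe _ _ hA) (fun _ B hB => hHe _ _ hB)
      (fun _ B _ hB => E1 S₃ hB)
      (fun A _ => by
        have heq : ∑ B ∈ S₂, H ΛF B * (L * (B.card * Cs)) = L * Cs * ∑ B ∈ S₂, (B.card : ℝ) * H ΛF B := by
          rw [mul_sum]; exact sum_congr rfl fun B _ => by ring
        rw [heq]; exact mul_le_mul_of_nonneg_left (E2 S₂ hF) (by positivity))
      (by rw [← sum_mul, mul_comm]; exact mul_le_mul_of_nonneg_left (E1 S₁ hF) (by positivity))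
  -- the sixteen trees
  have t1 : ∑ X ∈ T, ∑ Y ∈ T', ∑ Z ∈ T'', H ΛF X * H ΛF Y * H ΛF Z ≤ (L * (ΛF.card * Cs)) * ((L * (ΛF.card * Cs)) * (L * (ΛF.card * Cs))) := by
    exact (sum_congr rfl fun _ _ => sum_congr rfl fun _ _ => sum_congr rfl fun _ _ => by ring).trans_le (Sa T T' T'')
  have t2 : ∑ X ∈ T, ∑ Y ∈ T', ∑ Z ∈ T'', H ΛF X * H X Y * H X Z ≤ L * Cs * (L * Cs) * (L₃ * (ΛF.card * Cs)) := by
    exact (sum_congr rfl fun _ _ => sum_congr rfl fun _ _ => sum_congr rfl fun _ _ => by ring).trans_le (Sb T T' T'')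
  have t3 : ∑ X ∈ T, ∑ Y ∈ T', ∑ Z ∈ T'', H Y X * H ΛF Y * H Y Z ≤ L * Cs * (L * Cs) * (L₃ * (ΛF.card * Cs)) := by
    rw [Finset.sum_comm]
    exact (sum_congr rfl fun _ _ => sum_congr rfl fun _ _ => sum_congr rfl fun _ _ => by ring).trans_le (Sb T' T T'')
  have t4 : ∑ X ∈ T, ∑ Y ∈ T', ∑ Z ∈ T'', H Z X * H Z Y * H ΛF Z ≤ L * Cs * (L * Cs) * (L₃ * (ΛF.card * Cs)) := by
    simp only [Finset.sum_comm (s := T') (t := T'')]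
    rw [Finset.sum_comm]
    exact (sum_congr rfl fun _ _ => sum_congr rfl fun _ _ => sum_congr rfl fun _ _ => by ring).trans_le (Sb T'' T T')
  have t5 : ∑ X ∈ T, ∑ Y ∈ T', ∑ Z ∈ T'', H ΛF X * H X Y * H Y Z ≤ L * Cs * (L₂ * Cs) * (L₂ * (ΛF.card * Cs)) := by
    exact (sum_congr rfl fun _ _ => sum_congr rfl fun _ _ => sum_congr rfl fun _ _ => by ring).trans_le (Sc T T' T'')
  have t6 : ∑ X ∈ T, ∑ Y ∈ T', ∑ Z ∈ T'', H ΛF X * H Z Y * H X Z ≤ L * Cs * (L₂ * Cs) * (L₂ * (ΛF.card * Cs)) := by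
    simp only [Finset.sum_comm (s := T') (t := T'')]
    exact (sum_congr rfl fun _ _ => sum_congr rfl fun _ _ => sum_congr rfl fun _ _ => by ring).trans_le (Sc T T'' T')
  have t7 : ∑ X ∈ T, ∑ Y ∈ T', ∑ Z ∈ T'', H Y X * H ΛF Y * H X Z ≤ L * Cs * (L₂ * Cs) * (L₂ * (ΛF.card * Cs)) := by
    rw [Finset.sum_comm]
    exact (sum_congr rfl fun _ _ => sum_congr rfl fun _ _ => sum_congr rfl fun _ _ => by ring).trans_le (Sc T' T T'')
  have t8 : ∑ X ∈ T, ∑ Y ∈ T', ∑ Z ∈ T'', H Z X * H ΛF Y * H Y Z ≤ L * Cs * (L₂ * Cs) * (L₂ * (ΛF.card * Cs)) := by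
    rw [Finset.sum_comm]
    simp only [Finset.sum_comm (s := T) (t := T'')]
    exact (sum_congr rfl fun _ _ => sum_congr rfl fun _ _ => sum_congr rfl fun _ _ => by ring).trans_le (Sc T' T'' T)
  have t9 : ∑ X ∈ T, ∑ Y ∈ T', ∑ Z ∈ T'', H Z X * H X Y * H ΛF Z ≤ L * Cs * (L₂ * Cs) * (L₂ * (ΛF.card * Cs)) := by
    simp only [Finset.sum_comm (s := T') (t := T'')]
    rw [Finset.sum_comm]
    exact (sum_congr rfl fun _ _ => sum_congr rfl fun _ _ => sum_congr rfl fun _ _ => by ring).trans_le (Sc T'' T T')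
  have t10 : ∑ X ∈ T, ∑ Y ∈ T', ∑ Z ∈ T'', H Y X * H Z Y * H ΛF Z ≤ L * Cs * (L₂ * Cs) * (L₂ * (ΛF.card * Cs)) := by
    rw [Finset.sum_comm]
    simp only [Finset.sum_comm (s := T) (t := T'')]
    rw [Finset.sum_comm]
    exact (sum_congr rfl fun _ _ => sum_congr rfl fun _ _ => sum_congr rfl fun _ _ => by ring).trans_le (Sc T'' T' T)
  have t11 : ∑ X ∈ T, ∑ Y ∈ T', ∑ Z ∈ T'', H ΛF X * H ΛF Y * H Y Z ≤ L * Cs * (L₂ * (ΛF.card * Cs)) * (L * (ΛF.card * Cs)) := by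
    exact (sum_congr rfl fun _ _ => sum_congr rfl fun _ _ => sum_congr rfl fun _ _ => by ring).trans_le (Sd T T' T'')
  have t12 : ∑ X ∈ T, ∑ Y ∈ T', ∑ Z ∈ T'', H ΛF X * H Z Y * H ΛF Z ≤ L * Cs * (L₂ * (ΛF.card * Cs)) * (L * (ΛF.card * Cs)) := by
    simp only [Finset.sum_comm (s := T') (t := T'')]
    exact (sum_congr rfl fun _ _ => sum_congr rfl fun _ _ => sum_congr rfl fun _ _ => by ring).trans_le (Sd T T'' T')
  have t13 : ∑ X ∈ T, ∑ Y ∈ T', ∑ Z ∈ T'', H ΛF X * H ΛF Y * H X Z ≤ L * Cs * (L₂ * (ΛF.card * Cs)) * (L * (ΛF.card * Cs)) := by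
    rw [Finset.sum_comm]
    exact (sum_congr rfl fun _ _ => sum_congr rfl fun _ _ => sum_congr rfl fun _ _ => by ring).trans_le (Sd T' T T'')
  have t14 : ∑ X ∈ T, ∑ Y ∈ T', ∑ Z ∈ T'', H Z X * H ΛF Y * H ΛF Z ≤ L * Cs * (L₂ * (ΛF.card * Cs)) * (L * (ΛF.card * Cs)) := by
    rw [Finset.sum_comm]
    simp only [Finset.sum_comm (s := T) (t := T'')]
    exact (sum_congr rfl fun _ _ => sum_congr rfl fun _ _ => sum_congr rfl fun _ _ => by ring).trans_le (Sd T' T'' T)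
  have t15 : ∑ X ∈ T, ∑ Y ∈ T', ∑ Z ∈ T'', H ΛF X * H X Y * H ΛF Z ≤ L * Cs * (L₂ * (ΛF.card * Cs)) * (L * (ΛF.card * Cs)) := by
    simp only [Finset.sum_comm (s := T') (t := T'')]
    rw [Finset.sum_comm]
    exact (sum_congr rfl fun _ _ => sum_congr rfl fun _ _ => sum_congr rfl fun _ _ => by ring).trans_le (Sd T'' T T')
  have t16 : ∑ X ∈ T, ∑ Y ∈ T', ∑ Z ∈ T'', H Y X * H ΛF Y * H ΛF Z ≤ L * Cs * (L₂ * (ΛF.card * Cs)) * (L * (ΛF.card * Cs)) := by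
    rw [Finset.sum_comm]
    simp only [Finset.sum_comm (s := T) (t := T'')]
    rw [Finset.sum_comm]
    exact (sum_congr rfl fun _ _ => sum_congr rfl fun _ _ => sum_congr rfl fun _ _ => by ring).trans_le (Sd T'' T' T)
  -- assemble
  have hsummand : ∀ X Y Z : Finset (ZdEdge d), LX X * LX Y * LX Z *
        ((∑ e ∈ X, gD ΛF e) * (∑ e ∈ Y, gD ΛF e) * (∑ e ∈ Z, gD ΛF e) +
        (∑ e ∈ X, gD ΛF e) * (∑ e ∈ Y, gD X e) * (∑ e ∈ Z, gD X e) +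
        (∑ e ∈ Y, gD ΛF e) * (∑ e ∈ X, gD Y e) * (∑ e ∈ Z, gD Y e) +
        (∑ e ∈ Z, gD ΛF e) * (∑ e ∈ X, gD Z e) * (∑ e ∈ Y, gD Z e) +
        (∑ e ∈ X, gD ΛF e) * (∑ e ∈ Y, gD X e) * (∑ e ∈ Z, gD Y e) +
        (∑ e ∈ X, gD ΛF e) * (∑ e ∈ Z, gD X e) * (∑ e ∈ Y, gD Z e) +
        (∑ e ∈ Y, gD ΛF e) * (∑ e ∈ X, gD Y e) * (∑ e ∈ Z, gD X e) +
        (∑ e ∈ Y, gD ΛF e) * (∑ e ∈ Z, gD Y e) * (∑ e ∈ X, gD Z e) +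
        (∑ e ∈ Z, gD ΛF e) * (∑ e ∈ X, gD Z e) * (∑ e ∈ Y, gD X e) +
        (∑ e ∈ Z, gD ΛF e) * (∑ e ∈ Y, gD Z e) * (∑ e ∈ X, gD Y e) +
        (∑ e ∈ X, gD ΛF e) * (∑ e ∈ Y, gD ΛF e) * (∑ e ∈ Z, gD Y e) +
        (∑ e ∈ X, gD ΛF e) * (∑ e ∈ Z, gD ΛF e) * (∑ e ∈ Y, gD Z e) +
        (∑ e ∈ Y, gD ΛF e) * (∑ e ∈ X, gD ΛF e) * (∑ e ∈ Z, gD X e) +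
        (∑ e ∈ Y, gD ΛF e) * (∑ e ∈ Z, gD ΛF e) * (∑ e ∈ X, gD Z e) +
        (∑ e ∈ Z, gD ΛF e) * (∑ e ∈ X, gD ΛF e) * (∑ e ∈ Y, gD X e) +
        (∑ e ∈ Z, gD ΛF e) * (∑ e ∈ Y, gD ΛF e) * (∑ e ∈ X, gD Y e)) =
      H ΛF X * H ΛF Y * H ΛF Z +
      H ΛF X * H X Y * H X Z +
      H Y X * H ΛF Y * H Y Z +
      H Z X * H Z Y * H ΛF Z +
      H ΛF X * H X Y * H Y Z +
      H ΛF X * H Z Y * H X Z +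
      H Y X * H ΛF Y * H X Z +
      H Z X * H ΛF Y * H Y Z +
      H Z X * H X Y * H ΛF Z +
      H Y X * H Z Y * H ΛF Z +
      H ΛF X * H ΛF Y * H Y Z +
      H ΛF X * H Z Y * H ΛF Z +
      H ΛF X * H ΛF Y * H X Z +
      H Z X * H ΛF Y * H ΛF Z +
      H ΛF X * H X Y * H ΛF Z +
      H Y X * H ΛF Y * H ΛF Z := fun X Y Z => by
    simp only [hH]; ring
  have hsplit : ∑ X ∈ T, ∑ Y ∈ T', ∑ Z ∈ T'', LX X * LX Y * LX Z *
        ((∑ e ∈ X, gD ΛF e) * (∑ e ∈ Y, gD ΛF e) * (∑ e ∈ Z, gD ΛF e) +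
        (∑ e ∈ X, gD ΛF e) * (∑ e ∈ Y, gD X e) * (∑ e ∈ Z, gD X e) +
        (∑ e ∈ Y, gD ΛF e) * (∑ e ∈ X, gD Y e) * (∑ e ∈ Z, gD Y e) +
        (∑ e ∈ Z, gD ΛF e) * (∑ e ∈ X, gD Z e) * (∑ e ∈ Y, gD Z e) +
        (∑ e ∈ X, gD ΛF e) * (∑ e ∈ Y, gD X e) * (∑ e ∈ Z, gD Y e) +
        (∑ e ∈ X, gD ΛF e) * (∑ e ∈ Z, gD X e) * (∑ e ∈ Y, gD Z e) +
        (∑ e ∈ Y, gD ΛF e) * (∑ e ∈ X, gD Y e) * (∑ e ∈ Z, gD X e) +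
        (∑ e ∈ Y, gD ΛF e) * (∑ e ∈ Z, gD Y e) * (∑ e ∈ X, gD Z e) +
        (∑ e ∈ Z, gD ΛF e) * (∑ e ∈ X, gD Z e) * (∑ e ∈ Y, gD X e) +
        (∑ e ∈ Z, gD ΛF e) * (∑ e ∈ Y, gD Z e) * (∑ e ∈ X, gD Y e) +
        (∑ e ∈ X, gD ΛF e) * (∑ e ∈ Y, gD ΛF e) * (∑ e ∈ Z, gD Y e) +
        (∑ e ∈ X, gD ΛF e) * (∑ e ∈ Z, gD ΛF e) * (∑ e ∈ Y, gD Z e) +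
        (∑ e ∈ Y, gD ΛF e) * (∑ e ∈ X, gD ΛF e) * (∑ e ∈ Z, gD X e) +
        (∑ e ∈ Y, gD ΛF e) * (∑ e ∈ Z, gD ΛF e) * (∑ e ∈ X, gD Z e) +
        (∑ e ∈ Z, gD ΛF e) * (∑ e ∈ X, gD ΛF e) * (∑ e ∈ Y, gD X e) +
        (∑ e ∈ Z, gD ΛF e) * (∑ e ∈ Y, gD ΛF e) * (∑ e ∈ X, gD Y e)) =
      ∑ X ∈ T, ∑ Y ∈ T', ∑ Z ∈ T'', H ΛF X * H ΛF Y * H ΛF Z +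
      ∑ X ∈ T, ∑ Y ∈ T', ∑ Z ∈ T'', H ΛF X * H X Y * H X Z +
      ∑ X ∈ T, ∑ Y ∈ T', ∑ Z ∈ T'', H Y X * H ΛF Y * H Y Z +
      ∑ X ∈ T, ∑ Y ∈ T', ∑ Z ∈ T'', H Z X * H Z Y * H ΛF Z +
      ∑ X ∈ T, ∑ Y ∈ T', ∑ Z ∈ T'', H ΛF X * H X Y * H Y Z +
      ∑ X ∈ T, ∑ Y ∈ T', ∑ Z ∈ T'', H ΛF X * H Z Y * H X Z +
      ∑ X ∈ T, ∑ Y ∈ T', ∑ Z ∈ T'', H Y X * H ΛF Y * H X Z +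
      ∑ X ∈ T, ∑ Y ∈ T', ∑ Z ∈ T'', H Z X * H ΛF Y * H Y Z +
      ∑ X ∈ T, ∑ Y ∈ T', ∑ Z ∈ T'', H Z X * H X Y * H ΛF Z +
      ∑ X ∈ T, ∑ Y ∈ T', ∑ Z ∈ T'', H Y X * H Z Y * H ΛF Z +
      ∑ X ∈ T, ∑ Y ∈ T', ∑ Z ∈ T'', H ΛF X * H ΛF Y * H Y Z +
      ∑ X ∈ T, ∑ Y ∈ T', ∑ Z ∈ T'', H ΛF X * H Z Y * H ΛF Z +
      ∑ X ∈ T, ∑ Y ∈ T', ∑ Z ∈ T'', H ΛF X * H ΛF Y * H X Z +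
      ∑ X ∈ T, ∑ Y ∈ T', ∑ Z ∈ T'', H Z X * H ΛF Y * H ΛF Z +
      ∑ X ∈ T, ∑ Y ∈ T', ∑ Z ∈ T'', H ΛF X * H X Y * H ΛF Z +
      ∑ X ∈ T, ∑ Y ∈ T', ∑ Z ∈ T'', H Y X * H ΛF Y * H ΛF Z := by
    rw [sum_congr rfl fun X _ => sum_congr rfl fun Y _ => sum_congr rfl fun Z _ => hsummand X Y Z]
    simp only [sum_add_distrib]
  have hfin : ∑ X ∈ T, ∑ Y ∈ T', ∑ Z ∈ T'', H ΛF X * H ΛF Y * H ΛF Z +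
      ∑ X ∈ T, ∑ Y ∈ T', ∑ Z ∈ T'', H ΛF X * H X Y * H X Z +
      ∑ X ∈ T, ∑ Y ∈ T', ∑ Z ∈ T'', H Y X * H ΛF Y * H Y Z +
      ∑ X ∈ T, ∑ Y ∈ T', ∑ Z ∈ T'', H Z X * H Z Y * H ΛF Z +
      ∑ X ∈ T, ∑ Y ∈ T', ∑ Z ∈ T'', H ΛF X * H X Y * H Y Z +
      ∑ X ∈ T, ∑ Y ∈ T', ∑ Z ∈ T'', H ΛF X * H Z Y * H X Z +
      ∑ X ∈ T, ∑ Y ∈ T', ∑ Z ∈ T'', H Y X * H ΛF Y * H X Z +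
      ∑ X ∈ T, ∑ Y ∈ T', ∑ Z ∈ T'', H Z X * H ΛF Y * H Y Z +
      ∑ X ∈ T, ∑ Y ∈ T', ∑ Z ∈ T'', H Z X * H X Y * H ΛF Z +
      ∑ X ∈ T, ∑ Y ∈ T', ∑ Z ∈ T'', H Y X * H Z Y * H ΛF Z +
      ∑ X ∈ T, ∑ Y ∈ T', ∑ Z ∈ T'', H ΛF X * H ΛF Y * H Y Z +
      ∑ X ∈ T, ∑ Y ∈ T', ∑ Z ∈ T'', H ΛF X * H Z Y * H ΛF Z +
      ∑ X ∈ T, ∑ Y ∈ T', ∑ Z ∈ T'', H ΛF X * H ΛF Y * H X Z +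
      ∑ X ∈ T, ∑ Y ∈ T', ∑ Z ∈ T'', H Z X * H ΛF Y * H ΛF Z +
      ∑ X ∈ T, ∑ Y ∈ T', ∑ Z ∈ T'', H ΛF X * H X Y * H ΛF Z +
      ∑ X ∈ T, ∑ Y ∈ T', ∑ Z ∈ T'', H Y X * H ΛF Y * H ΛF Z ≤
      (L * (ΛF.card * Cs)) * ((L * (ΛF.card * Cs)) * (L * (ΛF.card * Cs))) +
      L * Cs * (L * Cs) * (L₃ * (ΛF.card * Cs)) +
      L * Cs * (L * Cs) * (L₃ * (ΛF.card * Cs)) +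
      L * Cs * (L * Cs) * (L₃ * (ΛF.card * Cs)) +
      L * Cs * (L₂ * Cs) * (L₂ * (ΛF.card * Cs)) +
      L * Cs * (L₂ * Cs) * (L₂ * (ΛF.card * Cs)) +
      L * Cs * (L₂ * Cs) * (L₂ * (ΛF.card * Cs)) +
      L * Cs * (L₂ * Cs) * (L₂ * (ΛF.card * Cs)) +
      L * Cs * (L₂ * Cs) * (L₂ * (ΛF.card * Cs)) +
      L * Cs * (L₂ * Cs) * (L₂ * (ΛF.card * Cs)) +
      L * Cs * (L₂ * (ΛF.card * Cs)) * (L * (ΛF.card * Cs)) +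
      L * Cs * (L₂ * (ΛF.card * Cs)) * (L * (ΛF.card * Cs)) +
      L * Cs * (L₂ * (ΛF.card * Cs)) * (L * (ΛF.card * Cs)) +
      L * Cs * (L₂ * (ΛF.card * Cs)) * (L * (ΛF.card * Cs)) +
      L * Cs * (L₂ * (ΛF.card * Cs)) * (L * (ΛF.card * Cs)) +
      L * Cs * (L₂ * (ΛF.card * Cs)) * (L * (ΛF.card * Cs)) := by
    refine add_le_add ?_ t16
    refine add_le_add ?_ t15
    refine add_le_add ?_ t14
    refine add_le_add ?_ t13
    refine add_le_add ?_ t12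
    refine add_le_add ?_ t11
    refine add_le_add ?_ t10
    refine add_le_add ?_ t9
    refine add_le_add ?_ t8
    refine add_le_add ?_ t7
    refine add_le_add ?_ t6
    refine add_le_add ?_ t5
    refine add_le_add ?_ t4
    refine add_le_add ?_ t3
    refine add_le_add ?_ t2
    exact t1
  rw [hsplit]
  refine hfin.trans (le_of_eq ?_)
  ring

end Summit.Ventures.YMGap.RobustBall

end
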